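import Literature.MathematicalPhysics.QuantumLattice.TIVariationalPressure
import Literature.MathematicalPhysics.QuantumLattice.FermionProductStateRegionEntropy
import Literature.MathematicalPhysics.QuantumLattice.SingleDirectionHoppingKinematicRow
import HarnessLib

/-!
# T > 0 DIMENSION RAISING for the variational pressure: layered crystals `ℤ^{d+1} = ℤ × ℤ^d`
# `P_d(β, Φ) ≤ P_{d+1}(β, Ψ_layered) ≤ P_d(β, Φ) + |β|·(4/π)Σ_b|tz_b|`, and layer marginals of `(d+1)`-dimensional
# equilibrium states are `ε`-approximate `d`-dimensional equilibria

Topic `Literature/MathematicalPhysics/QuantumLattice` (family `hubbard`; crew hubbard-fast S2, D-0096 (iii) «model order → real T_c: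
interlayer coupling» at `T > 0` in the THERMODYNAMIC LIMIT). The `T = 0` statement is `LayeredLatticeEnergyTransport` /
`SingleDirectionHoppingKinematicRow` §4 (fixed-filling ground-state energy densities of a layered crystal lie in
`[e_ρ(one band) − (4/π)Σ|tz|, e_ρ(one band)]`); the finite-volume `T > 0` statement is `LayeredSystemPartitionFunction`
(`log Z` of decoupled vs coupled layers). This file is the `T > 0` THERMODYNAMIC-LIMIT statement, for Araki–Moriya's variational
pressure `P(β,Ψ) = sup_{ω TI} [s̄(ω) − β e_Ψ(ω)]` of `TIVariationalPressure` (`s̄` the upper box-entropy density):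

* §1 **Entropy densities under stacking and layering.** The stack `⊗_k ω₀` of an even `d`-dimensional state has
  `S((⊗ω₀)|_{[0,ℓ)^{d+1}})/ℓ^{d+1} = S(ω₀|_{[0,ℓ)^d})/ℓ^d` (`ℓ ≥ 1`) hence **`s̄(⊗ω₀) = s̄(ω₀)`** (`entropyDensitySup_stack`,
  from `FermionProductStateRegionEntropy`); every translation-invariant state `ω` of `ℤ^{d+1}` (`d ≥ 1`) has
  `S(ω|_{[0,ℓ)^{d+1}})/ℓ^{d+1} ≤ S((ω∘Γ_layer)|_{[0,ℓ)^d})/ℓ^d` hence **`s̄(ω) ≤ s̄(ω ∘ Γ_layer)`**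
  (`IsTranslationInvariant.entropyDensitySup_le_layerMarginal`, from the layer subadditivity of `InfVolFermionStateRegionEntropy`).
* §2 **Abstract dimension raising.** For interactions `Φ` on `ℤ^d` and `Ψ` on `ℤ^{d+1}` (`d ≥ 1`):
  (FLOOR) if every stack has `e_Ψ(⊗ω₀) = e_Φ(ω₀)` then `P_d(β,Φ) ≤ P_{d+1}(β,Ψ)` (`varPressure_le_of_stack`: the stacks are
  trial states with the `d`-dimensional entropy and energy); (CAP) if every translation-invariant `ω` has
  `|e_Ψ(ω) − e_Φ(ω ∘ Γ_layer)| ≤ C` then `P_{d+1}(β,Ψ) ≤ P_d(β,Φ) + |β|C` (`varPressure_le_of_layerMarginal`: §1 + the trial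
  principle for the marginal); two-sided form; and **EQUILIBRIUM MARGINALS**: an equilibrium state `ω` of `(β, Ψ)` has a layer
  marginal with `s̄ − βe_Φ ≥ P_d(β,Φ) − |β|C` (`IsVarEquilibrium.varPressure_sub_le_layerMarginal`), an `ε`-APPROXIMATE EQUILIBRIUM.
* §3 **`ε`-approximate equilibria obey the tangent inequalities up to `ε`** (any dimension, any interaction): the master
  inequality `P(β₁,Φ₁) ≥ P(β,Φ) + βe_Φ(ν) − β₁e_{Φ₁}(ν) − ε` (`varPressure_add_le_of_approx`), the coupling-update form along linear
  families `P(θ + δ1_a) ≥ P(θ) − βδ e_a(ν) − ε` (`varPressure_sub_mul_le_update_of_approx`), and the **GRIFFITHS WINDOW WITH SLACK**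
  `e_a(ν) ∈ [(P(θ) − P(θ+δ1_a) − ε)/(βδ), (P(θ−δ1_a) − P(θ) + ε)/(βδ)]` (`meanEnergy_mem_Icc_of_approx`, `β, δ > 0`): three pressures of
  the LOWER-dimensional model certify the conjugate densities of the layer marginals of HIGHER-dimensional thermal states.
* §4 **Layered one-band crystals** (`layeredModel U u θ w tz` of `LayeredLatticeEnergyTransport`: in-plane one-band model
  `vectorHoppingModel U u θ`, interlayer hoppings `tz_b` along vectors `w_b` with `(w_b)₀ ≠ 0`): the hypotheses of §2 hold with
  `C = (4/π)Σ_b|tz_b|` (stack energies `meanEnergy_stack_layeredModel`; marginal energies `meanEnergy_layeredModel_eq_mapAct_add` + the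
  single-direction kinematic row `|K_w(ω)| ≤ 4/π`), so **`P_{d+1}(β, layered) ∈ [P_d(β, one band), P_d + |β|(4/π)Σ|tz|]`**
  (`varPressure_layeredModel_mem_Icc`), **equality at `tz = 0`** (`varPressure_layeredModel_zero`), the Lipschitz bound in `tz`, and the
  equilibrium-marginal statement; the `t–t'` Hubbard layer (`layeredHubbardTTPrime`) as the instance
  (`varPressure_layeredHubbardTTPrime_mem_Icc`). The grand-canonical dressing (`−μn − hm`) and the identification of the 2D side
  with `gcPressureTT'Zeeman` are the companion file `LayeredHubbardGrandCanonicalVariationalPressure`.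

Everything is PROVED; no definition, no named fact, no number. HONEST SCOPE: `P_{d+1}` is the VARIATIONAL pressure of the layered
crystal (no `(d+1)`-dimensional thermodynamic-limit theorem for partition functions is claimed); the interlayer allowance is the
kinematic `4/π` per unit interlayer amplitude (sharp for free fermions along a line), not a perturbative `O(tz²)`.

## Mathlib / tree search

REUSED: `entropyDensitySup`, `boxEntropyDensity(_apply/_nonneg/_le)`, `varPressure`, `sub_mul_le_varPressure`, `varPressure_le`,
`IsVarEquilibrium`, `meanEnergy_linearFamily_eq_add_sum_sub_mul` (`TIVariationalPressure`, `TIGroundEnergyDensityCouplingFamilies`);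
`vonNeumannEntropy_rdm_stack_halfOpenBox` (`FermionProductStateRegionEntropy`); `IsTranslationInvariant.vonNeumannEntropy_rdm_halfOpenBox_le_layers`,
`vonNeumannEntropy_rdm_congr`, `vonNeumannEntropy_rdm_empty` (`InfVolFermionStateRegionEntropy`); `stack`, `stack_isTranslationInvariant`,
`layerHom`, `layeredModel`, `vectorHoppingModel`, `meanEnergy_stack_layeredModel`, `IsTranslationInvariant.meanEnergy_layeredModel_eq_mapAct_add`,
`layeredHubbardTTPrime`, `hubbardTTPrimeFermionInteraction_eq_vectorHoppingModel`, `ttPrimeVec_ne_zero`, `ttPrimeVec_mem_thicken_one`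
(`LayeredLatticeEnergyTransport`); `IsTranslationInvariant.abs_meanEnergy_vectorHopping_le_four_div_pi` (`SingleDirectionHoppingKinematicRow`);
`IsTranslationInvariant.mapAct`, `IsTranslationInvariant.isEven`; Mathlib `Filter.limsup_congr`, `Filter.limsup_le_limsup`.
`lean search 'varPressure.*layer|entropyDensitySup_stack|dimension rais'` (2026-08-28): nothing at `T > 0`.

## References

* H. Araki, H. Moriya, Rev. Math. Phys. 15 (2003) 93–198, §11.1 Thm. 11.2 (product states), Thm. 3.8/§10 (entropy),
  §12 (variational principle and its solutions). [cite: ArakiMoriya2003, §11.1 Theorem 11.2]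
* R. B. Israel, *Convexity in the Theory of Lattice Gases* (1979), Thm. I.2.4, Thm. I.3.4 (tangent functionals, Lipschitz continuity of the
  pressure in the interaction). [cite: Israel1979, Thm. I.3.4]
* O. Bratteli, A. Kishimoto, D. W. Robinson, Commun. Math. Phys. 64 (1978) 41, Thm. 2 (ground/equilibrium states of layered vs
  decoupled systems as the interlayer coupling is switched on). [cite: BratteliKishimotoRobinson1978, Thm. 2 (condition 2)]
* E. H. Lieb, F. Y. Wu, Physica A 321 (2003) 1, §4 (the `4/π` free-chain bond energy behind the single-direction row).
  [cite: LiebWuPhysicaA2003, §4 and §6 Remark (A)]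
-/

noncomputable section

open scoped ComplexOrder BigOperators
open Finset Literature.InformationTheory.Entropy

namespace Literature.MathematicalPhysics.QuantumLattice

open Matrix HubbardWave0 Literature.Probability.LatticeModels ThermodynamicLimit
open _root_.Filter
open scoped _root_.Topology

/-! ### §1 Entropy densities under stacking and layering -/

namespace InfVolFermionState

variable {d : ℕ}

/-- The box `[0,0)^{d+1}` is empty. [cite: FriedliVelenik2017, §3.2] -/
theorem halfOpenBox_succ_zero (d : ℕ) : halfOpenBox (d + 1) 0 = ∅ :=
  Finset.eq_empty_of_forall_notMem fun x hx => by
    have h := (mem_halfOpenBox.1 hx) 0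
    push_cast at h
    omega

/-- **Box-entropy densities of a stack**: `S((⊗ω₀)|_{[0,ℓ)^{d+1}})/ℓ^{d+1} = S(ω₀|_{[0,ℓ)^d})/ℓ^d` for `ℓ ≥ 1`.
[cite: BratteliRobinsonII1997, Thm. 6.2.40] [cite: ArakiMoriya2003, §11.1 Theorem 11.2] -/
theorem boxEntropyDensity_stack (ω₀ : InfVolFermionState d) (h : ω₀.IsEven) {ℓ : ℕ} (hℓ : 1 ≤ ℓ) :
    (ω₀.stack h).boxEntropyDensity ℓ = ω₀.boxEntropyDensity ℓ := by
  rw [boxEntropyDensity_apply, boxEntropyDensity_apply, ω₀.vonNeumannEntropy_rdm_stack_halfOpenBox h ℓ, pow_succ,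
    mul_comm ((ℓ : ℝ) ^ d) (ℓ : ℝ)]
  have hℓ0 : (ℓ : ℝ) ≠ 0 := by exact_mod_cast (by omega : ℓ ≠ 0)
  exact mul_div_mul_left _ _ hℓ0

/-- **The stack has the entropy density of the layer state**: `s̄(⊗ω₀) = s̄(ω₀)`.
[cite: BratteliRobinsonII1997, Thm. 6.2.40] [cite: ArakiMoriya2003, §11.1 Theorem 11.2] -/
theorem entropyDensitySup_stack (ω₀ : InfVolFermionState d) (h : ω₀.IsEven) :
    (ω₀.stack h).entropyDensitySup = ω₀.entropyDensitySup := by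
  rw [entropyDensitySup, entropyDensitySup]
  refine Filter.limsup_congr ?_
  filter_upwards [Filter.eventually_ge_atTop 1] with ℓ hℓ
  exact ω₀.boxEntropyDensity_stack h hℓ

/-- **Layer subadditivity per volume**: for a translation-invariant state `ω` of `ℤ^{d+1}`,
`S(ω|_{[0,ℓ)^{d+1}})/ℓ^{d+1} ≤ S((ω∘Γ_layer)|_{[0,ℓ)^d})/ℓ^d` for every `ℓ`. [cite: ArakiMoriya2003, Theorem 3.8 and §10] -/
theorem IsTranslationInvariant.boxEntropyDensity_le_layerMarginal {ω : InfVolFermionState (d + 1)}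
    (hω : ω.IsTranslationInvariant) (ℓ : ℕ) :
    ω.boxEntropyDensity ℓ ≤ (ω.mapAct (layerHom d) (layerHom_injective d)).boxEntropyDensity ℓ := by
  rcases Nat.eq_zero_or_pos ℓ with rfl | hℓ
  · rw [boxEntropyDensity_apply, ω.vonNeumannEntropy_rdm_congr (halfOpenBox_succ_zero d), ω.vonNeumannEntropy_rdm_empty,
      zero_div]
    exact boxEntropyDensity_nonneg _ _
  · have h := hω.vonNeumannEntropy_rdm_halfOpenBox_le_layers ℓ
    have hℓ0 : (0 : ℝ) < ℓ := by exact_mod_cast hℓ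
    rw [boxEntropyDensity_apply, boxEntropyDensity_apply, pow_succ, div_le_iff₀ (by positivity)]
    have e : vonNeumannEntropy ((ω.mapAct (layerHom d) (layerHom_injective d)).rdm (halfOpenBox d ℓ)) / (ℓ : ℝ) ^ d *
        ((ℓ : ℝ) ^ d * ℓ) = ℓ * vonNeumannEntropy ((ω.mapAct (layerHom d) (layerHom_injective d)).rdm (halfOpenBox d ℓ)) := by
      field_simp
    rw [e]
    exact h

/-- **A translation-invariant state of `ℤ^{d+1}` has at most the entropy density of its layer marginal**: `s̄(ω) ≤ s̄(ω ∘ Γ_layer)`.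
[cite: ArakiMoriya2003, Theorem 3.8 and §10] [cite: BratteliRobinsonII1997, Thm. 6.2.40] -/
theorem IsTranslationInvariant.entropyDensitySup_le_layerMarginal {ω : InfVolFermionState (d + 1)}
    (hω : ω.IsTranslationInvariant) :
    ω.entropyDensitySup ≤ (ω.mapAct (layerHom d) (layerHom_injective d)).entropyDensitySup := by
  rw [entropyDensitySup, entropyDensitySup]
  refine Filter.limsup_le_limsup (Filter.Eventually.of_forall fun ℓ => hω.boxEntropyDensity_le_layerMarginal ℓ) ?_ ?_
  · exact isCoboundedUnder_le_of_le atTop fun ℓ => ω.boxEntropyDensity_nonneg ℓ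
  · exact isBoundedUnder_of ⟨2 * Real.log 2, fun ℓ => InfVolFermionState.boxEntropyDensity_le _ ℓ⟩

end InfVolFermionState

/-! ### §2 Abstract dimension raising: floor from stacks, cap from layer marginals, equilibrium marginals -/

section Abstract

variable {d : ℕ} (β : ℝ) {Φ : FermionInteraction d} {Ψ : FermionInteraction (d + 1)} {R R' C : ℝ}

/-- **FLOOR from stacks**: if the stack of every translation-invariant state of `ℤ^d` (`d ≥ 1`) evaluates `Ψ` exactly as the state
evaluates `Φ`, then `P_d(β,Φ) ≤ P_{d+1}(β,Ψ)` — the stacks are translation-invariant trial states of `ℤ^{d+1}` with the entropy density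
and the energy of the layer state. [cite: ArakiMoriya2003, §11.1 Theorem 11.2] [cite: Israel1979, Thm. I.3.4] -/
theorem varPressure_le_of_stack (hd : 0 < d)
    (hstack : ∀ (ω₀ : InfVolFermionState d) (hω₀ : ω₀.IsTranslationInvariant),
      (ω₀.stack (hω₀.isEven hd)).meanEnergy Ψ R' = ω₀.meanEnergy Φ R) :
    Φ.varPressure β R ≤ Ψ.varPressure β R' := by
  refine Φ.varPressure_le β R fun ω₀ hω₀ => ?_
  have h := Ψ.sub_mul_le_varPressure β R' (InfVolFermionState.stack_isTranslationInvariant hω₀ (hω₀.isEven hd))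
  rw [hstack ω₀ hω₀, InfVolFermionState.entropyDensitySup_stack] at h
  exact h

/-- **CAP from layer marginals**: if every translation-invariant state `ω` of `ℤ^{d+1}` has `|e_Ψ(ω) − e_Φ(ω ∘ Γ_layer)| ≤ C`, then
`P_{d+1}(β,Ψ) ≤ P_d(β,Φ) + |β|·C` (`s̄(ω) ≤ s̄(ω∘Γ_layer)` and the trial principle for the marginal).
[cite: Israel1979, Thm. I.3.4] [cite: BratteliKishimotoRobinson1978, Thm. 2 (condition 2)] -/
theorem varPressure_le_of_layerMarginal
    (hmarg : ∀ ω : InfVolFermionState (d + 1), ω.IsTranslationInvariant →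
      |ω.meanEnergy Ψ R' - (ω.mapAct (layerHom d) (layerHom_injective d)).meanEnergy Φ R| ≤ C) :
    Ψ.varPressure β R' ≤ Φ.varPressure β R + |β| * C := by
  refine Ψ.varPressure_le β R' fun ω hω => ?_
  have hm : (ω.mapAct (layerHom d) (layerHom_injective d)).IsTranslationInvariant :=
    hω.mapAct (layerHom d) (layerHom_injective d)
  have h1 := Φ.sub_mul_le_varPressure β R hm
  have h2 := hω.entropyDensitySup_le_layerMarginal
  have h3 : β * (ω.mapAct (layerHom d) (layerHom_injective d)).meanEnergy Φ R - β * ω.meanEnergy Ψ R' ≤ |β| * C := by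
    rw [← mul_sub]
    refine (le_abs_self _).trans ?_
    rw [abs_mul, abs_sub_comm]
    exact mul_le_mul_of_nonneg_left (hmarg ω hω) (abs_nonneg β)
  linarith

/-- **TWO-SIDED DIMENSION RAISING**: under both hypotheses `P_{d+1}(β,Ψ) ∈ [P_d(β,Φ), P_d(β,Φ) + |β|C]`.
[cite: BratteliKishimotoRobinson1978, Thm. 2 (condition 2)] [cite: Israel1979, Thm. I.3.4] -/
theorem varPressure_mem_Icc_of_stack_of_layerMarginal (hd : 0 < d)
    (hstack : ∀ (ω₀ : InfVolFermionState d) (hω₀ : ω₀.IsTranslationInvariant),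
      (ω₀.stack (hω₀.isEven hd)).meanEnergy Ψ R' = ω₀.meanEnergy Φ R)
    (hmarg : ∀ ω : InfVolFermionState (d + 1), ω.IsTranslationInvariant →
      |ω.meanEnergy Ψ R' - (ω.mapAct (layerHom d) (layerHom_injective d)).meanEnergy Φ R| ≤ C) :
    Ψ.varPressure β R' ∈ Set.Icc (Φ.varPressure β R) (Φ.varPressure β R + |β| * C) :=
  ⟨varPressure_le_of_stack β hd hstack, varPressure_le_of_layerMarginal β hmarg⟩

/-- **EQUILIBRIUM MARGINALS ARE APPROXIMATE EQUILIBRIA.** Under both hypotheses, the layer marginal `ω ∘ Γ_layer` of an equilibrium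
state `ω` of `(β, Ψ)` on `ℤ^{d+1}` is a translation-invariant state of `ℤ^d` with
`P_d(β,Φ) − |β|C ≤ s̄(ω∘Γ_layer) − β e_Φ(ω∘Γ_layer) (≤ P_d(β,Φ))`. [cite: BratteliKishimotoRobinson1978, Thm. 2 (condition 2)] [cite: ArakiMoriya2003, Theorem 12.11] -/
theorem InfVolFermionState.IsVarEquilibrium.varPressure_sub_le_layerMarginal (hd : 0 < d) {ω : InfVolFermionState (d + 1)}
    (hω : ω.IsVarEquilibrium β Ψ R')
    (hstack : ∀ (ω₀ : InfVolFermionState d) (hω₀ : ω₀.IsTranslationInvariant),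
      (ω₀.stack (hω₀.isEven hd)).meanEnergy Ψ R' = ω₀.meanEnergy Φ R)
    (hmarg : ∀ ω : InfVolFermionState (d + 1), ω.IsTranslationInvariant →
      |ω.meanEnergy Ψ R' - (ω.mapAct (layerHom d) (layerHom_injective d)).meanEnergy Φ R| ≤ C) :
    Φ.varPressure β R - |β| * C ≤
      (ω.mapAct (layerHom d) (layerHom_injective d)).entropyDensitySup -
        β * (ω.mapAct (layerHom d) (layerHom_injective d)).meanEnergy Φ R := by
  have hP := varPressure_le_of_stack β hd hstack
  have h2 := hω.1.entropyDensitySup_le_layerMarginal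
  have h3 : β * (ω.mapAct (layerHom d) (layerHom_injective d)).meanEnergy Φ R - β * ω.meanEnergy Ψ R' ≤ |β| * C := by
    rw [← mul_sub]
    refine (le_abs_self _).trans ?_
    rw [abs_mul, abs_sub_comm]
    exact mul_le_mul_of_nonneg_left (hmarg ω hω.1) (abs_nonneg β)
  have h4 := hω.2
  linarith

end Abstract

/-! ### §3 `ε`-approximate equilibria: tangent inequalities and Griffiths windows with slack -/

namespace InfVolFermionState

variable {d : ℕ} {β : ℝ} {Φ : FermionInteraction d} {R ε : ℝ} {ν : InfVolFermionState d}

/-- **Master inequality with slack**: if `ν` is translation invariant with `s̄(ν) − βe_Φ(ν) ≥ P(β,Φ) − ε` then for every `(β₁, Φ₁)`: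
`P(β₁,Φ₁) ≥ P(β,Φ) + βe_Φ(ν) − β₁e_{Φ₁}(ν) − ε`. [cite: Israel1979, Thm. I.2.4] -/
theorem varPressure_add_le_of_approx (hν : ν.IsTranslationInvariant)
    (h : Φ.varPressure β R - ε ≤ ν.entropyDensitySup - β * ν.meanEnergy Φ R)
    (β₁ : ℝ) (Φ₁ : FermionInteraction d) (R₁ : ℝ) :
    Φ.varPressure β R + β * ν.meanEnergy Φ R - β₁ * ν.meanEnergy Φ₁ R₁ - ε ≤ Φ₁.varPressure β₁ R₁ := by
  have h1 := Φ₁.sub_mul_le_varPressure β₁ R₁ hν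
  linarith

variable {ι : Type*} [Fintype ι] {Ψ₀ : FermionInteraction d} {Ψv : ι → FermionInteraction d}

/-- **Coupling update with slack**: for an `ε`-approximate equilibrium `ν` at couplings `θ` of the linear family `Ψ₀ + Σθ_aΨ_a`:
`P(θ + δ1_a) ≥ P(θ) − βδ e_a(ν) − ε`. [cite: Israel1979, Thm. I.2.4] -/
theorem varPressure_sub_mul_le_update_of_approx [DecidableEq ι] {θ : ι → ℝ} (hν : ν.IsTranslationInvariant)
    (h : (FermionInteraction.linearFamily Ψ₀ Ψv θ).varPressure β R - ε ≤
      ν.entropyDensitySup - β * ν.meanEnergy (FermionInteraction.linearFamily Ψ₀ Ψv θ) R) (a : ι) (δ : ℝ) :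
    (FermionInteraction.linearFamily Ψ₀ Ψv θ).varPressure β R - β * δ * ν.meanEnergy (Ψv a) R - ε ≤
      (FermionInteraction.linearFamily Ψ₀ Ψv (θ + Pi.single a δ)).varPressure β R := by
  set θ' : ι → ℝ := θ + Pi.single a δ with hθ'
  have hm := varPressure_add_le_of_approx hν h β (FermionInteraction.linearFamily Ψ₀ Ψv θ') R
  rw [ν.meanEnergy_linearFamily_eq_add_sum_sub_mul Ψ₀ Ψv θ' θ R] at hm
  have hs : ∑ x, (θ' x - θ x) * ν.meanEnergy (Ψv x) R = δ * ν.meanEnergy (Ψv a) R := by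
    simp only [hθ', Pi.add_apply, add_sub_cancel_left]
    rw [Finset.sum_eq_single a]
    · rw [Pi.single_eq_same]
    · intro b _ hb; rw [Pi.single_eq_of_ne hb, zero_mul]
    · intro ha; exact absurd (Finset.mem_univ a) ha
  rw [hs] at hm
  linarith

/-- **GRIFFITHS WINDOW WITH SLACK**: for an `ε`-approximate equilibrium `ν` at couplings `θ`, `β > 0` and a step `δ > 0` in the
coupling `a`: `(P(θ) − P(θ+δ1_a) − ε)/(βδ) ≤ e_a(ν) ≤ (P(θ−δ1_a) − P(θ) + ε)/(βδ)` — THREE pressures certify the conjugate density up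
to `ε/(βδ)`. [cite: Israel1979, Thm. I.2.4] [cite: Griffiths1964, Eq. (39) and Fig. 3] -/
theorem meanEnergy_mem_Icc_of_approx [DecidableEq ι] {θ : ι → ℝ} (hν : ν.IsTranslationInvariant) (hβ : 0 < β)
    (h : (FermionInteraction.linearFamily Ψ₀ Ψv θ).varPressure β R - ε ≤
      ν.entropyDensitySup - β * ν.meanEnergy (FermionInteraction.linearFamily Ψ₀ Ψv θ) R) (a : ι) {δ : ℝ} (hδ : 0 < δ) :
    ν.meanEnergy (Ψv a) R ∈ Set.Icc
      (((FermionInteraction.linearFamily Ψ₀ Ψv θ).varPressure β R -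
          (FermionInteraction.linearFamily Ψ₀ Ψv (θ + Pi.single a δ)).varPressure β R - ε) / (β * δ))
      (((FermionInteraction.linearFamily Ψ₀ Ψv (θ + Pi.single a (-δ))).varPressure β R -
          (FermionInteraction.linearFamily Ψ₀ Ψv θ).varPressure β R + ε) / (β * δ)) := by
  have hβδ : 0 < β * δ := mul_pos hβ hδ
  have hup := varPressure_sub_mul_le_update_of_approx hν h a δ
  have hdn := varPressure_sub_mul_le_update_of_approx hν h a (-δ)
  constructor
  · rw [div_le_iff₀ hβδ]; linarith
  · rw [le_div_iff₀ hβδ]; linarith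

end InfVolFermionState

/-! ### §4 Layered one-band crystals: `P_{d+1} ∈ [P_d, P_d + |β|(4/π)Σ|tz|]`, equality at `tz = 0` -/

section Layered

variable {d : ℕ} {ι κ : Type*} [Fintype ι] [Fintype κ]

/-- **Stack energies** (hypothesis (FLOOR) of §2 for layered crystals): the stack of a translation-invariant `ω₀` evaluates the
layered model exactly as `ω₀` evaluates the one-band model. [cite: ArakiMoriya2003, §11.1 Theorem 11.2] -/
theorem meanEnergy_stack_layeredModel_of_isTranslationInvariant (hd : 0 < d) (U : ℝ) {u : ι → Site d} (hu : ∀ a, u a ≠ 0)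
    (θ : ι → ℝ) {w : κ → Site (d + 1)} (hw : ∀ b, w b 0 ≠ 0) (tz : κ → ℝ) {R R' : ℝ} (hR : 1 ≤ R) (hRR' : R ≤ R')
    (huR : ∀ a, u a ∈ thicken ({0} : Finset (Site d)) R) (hwR' : ∀ b, w b ∈ thicken ({0} : Finset (Site (d + 1))) R')
    (ω₀ : InfVolFermionState d) (hω₀ : ω₀.IsTranslationInvariant) :
    (ω₀.stack (hω₀.isEven hd)).meanEnergy (layeredModel U u θ w tz) R' = ω₀.meanEnergy (vectorHoppingModel U u θ) R :=
  InfVolFermionState.meanEnergy_stack_layeredModel hω₀ _ U hu θ hw tz hR hRR' huR hwR'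

/-- **Marginal energies** (hypothesis (CAP) of §2 for layered crystals, sharp constant): for every translation-invariant `ω` of
`ℤ^{d+1}`, `|e_{layered}(ω) − e_{one band}(ω∘Γ_layer)| ≤ (4/π)Σ_b|tz_b|`. [cite: LiebWuPhysicaA2003, §4 and §6 Remark (A)] [cite: BratteliKishimotoRobinson1978, Thm. 2 (condition 2)] -/
theorem InfVolFermionState.IsTranslationInvariant.abs_meanEnergy_layeredModel_sub_mapAct_le {ω : InfVolFermionState (d + 1)}
    (hω : ω.IsTranslationInvariant) (U : ℝ) {u : ι → Site d} (hu : ∀ a, u a ≠ 0) (θ : ι → ℝ) {w : κ → Site (d + 1)}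
    (hw : ∀ b, w b ≠ 0) (tz : κ → ℝ) {R R' : ℝ} (hR : 1 ≤ R) (hRR' : R ≤ R')
    (huR : ∀ a, u a ∈ thicken ({0} : Finset (Site d)) R) (hwR' : ∀ b, w b ∈ thicken ({0} : Finset (Site (d + 1))) R') :
    |ω.meanEnergy (layeredModel U u θ w tz) R' -
        (ω.mapAct (layerHom d) (layerHom_injective d)).meanEnergy (vectorHoppingModel U u θ) R| ≤
      4 / Real.pi * ∑ b, |tz b| := by
  rw [hω.meanEnergy_layeredModel_eq_mapAct_add U hu θ w tz hR hRR' huR, add_sub_cancel_left, Finset.mul_sum]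
  refine (Finset.abs_sum_le_sum_abs _ _).trans (Finset.sum_le_sum fun b _ => ?_)
  have hK := hω.abs_meanEnergy_vectorHopping_le_four_div_pi (hw b) 1 (hwR' b)
  rw [abs_one, mul_one] at hK
  rw [abs_mul, mul_comm (4 / Real.pi)]
  exact mul_le_mul_of_nonneg_left hK (abs_nonneg _)

/-- **T > 0 DIMENSION RAISING FOR LAYERED CRYSTALS**: for `d ≥ 1`, in-plane bond vectors `u_a ≠ 0` in the range box `R ≥ 1`,
interlayer vectors `w_b` with `(w_b)₀ ≠ 0` in the range box `R' ≥ R`, and every `β`: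
`P_{d+1}(β, layered) ∈ [P_d(β, one band), P_d(β, one band) + |β|·(4/π)Σ_b|tz_b|]`.
[cite: BratteliKishimotoRobinson1978, Thm. 2 (condition 2)] [cite: Israel1979, Thm. I.3.4] -/
theorem varPressure_layeredModel_mem_Icc (hd : 0 < d) (β U : ℝ) {u : ι → Site d} (hu : ∀ a, u a ≠ 0) (θ : ι → ℝ)
    {w : κ → Site (d + 1)} (hw : ∀ b, w b 0 ≠ 0) (tz : κ → ℝ) {R R' : ℝ} (hR : 1 ≤ R) (hRR' : R ≤ R')
    (huR : ∀ a, u a ∈ thicken ({0} : Finset (Site d)) R) (hwR' : ∀ b, w b ∈ thicken ({0} : Finset (Site (d + 1))) R') :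
    (layeredModel U u θ w tz).varPressure β R' ∈
      Set.Icc ((vectorHoppingModel U u θ).varPressure β R)
        ((vectorHoppingModel U u θ).varPressure β R + |β| * (4 / Real.pi * ∑ b, |tz b|)) :=
  varPressure_mem_Icc_of_stack_of_layerMarginal β hd
    (meanEnergy_stack_layeredModel_of_isTranslationInvariant hd U hu θ hw tz hR hRR' huR hwR')
    (fun ω hω => hω.abs_meanEnergy_layeredModel_sub_mapAct_le U hu θ (fun b h0 => hw b (by rw [h0]; rfl)) tz hR hRR'
      huR hwR')

/-- **DECOUPLED LAYERS**: at `tz = 0` the layered crystal has EXACTLY the variational pressure of the one-band model,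
`P_{d+1}(β, layered(tz = 0)) = P_d(β, one band)`. [cite: ArakiMoriya2003, §11.1 Theorem 11.2] [cite: BratteliRobinsonII1997, Thm. 6.2.40] -/
theorem varPressure_layeredModel_zero (hd : 0 < d) (β U : ℝ) {u : ι → Site d} (hu : ∀ a, u a ≠ 0) (θ : ι → ℝ)
    {w : κ → Site (d + 1)} (hw : ∀ b, w b 0 ≠ 0) {R R' : ℝ} (hR : 1 ≤ R) (hRR' : R ≤ R')
    (huR : ∀ a, u a ∈ thicken ({0} : Finset (Site d)) R) (hwR' : ∀ b, w b ∈ thicken ({0} : Finset (Site (d + 1))) R') :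
    (layeredModel U u θ w fun _ => 0).varPressure β R' = (vectorHoppingModel U u θ).varPressure β R := by
  have h := varPressure_layeredModel_mem_Icc hd β U hu θ hw (fun _ => 0) hR hRR' huR hwR'
  simp only [abs_zero, Finset.sum_const_zero, mul_zero, add_zero] at h
  exact le_antisymm h.2 h.1

/-- **Lipschitz in the interlayer amplitudes**: `|P_{d+1}(β, layered(tz)) − P_{d+1}(β, layered(tz'))| ≤ |β|(4/π)Σ_b|tz_b − tz'_b|`
(every `w_b ≠ 0`; all translation-invariant states obey the single-direction row). [cite: Israel1979, Thm. I.3.4] [cite: LiebWuPhysicaA2003, §4 and §6 Remark (A)] -/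
theorem abs_varPressure_layeredModel_sub_le (U : ℝ) (u : ι → Site d) (θ : ι → ℝ) {w : κ → Site (d + 1)}
    (hw : ∀ b, w b ≠ 0) (tz tz' : κ → ℝ) (β : ℝ) {R' : ℝ} (hwR' : ∀ b, w b ∈ thicken ({0} : Finset (Site (d + 1))) R') :
    |(layeredModel U u θ w tz).varPressure β R' - (layeredModel U u θ w tz').varPressure β R'| ≤
      |β| * (4 / Real.pi * ∑ b, |tz b - tz' b|) := by
  refine (layeredModel U u θ w tz).abs_varPressure_sub_le β R' _ R' fun ω hω => ?_
  rw [InfVolFermionState.meanEnergy_layeredModel, InfVolFermionState.meanEnergy_layeredModel, add_sub_add_left_eq_sub,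
    ← Finset.sum_sub_distrib, Finset.mul_sum]
  refine (Finset.abs_sum_le_sum_abs _ _).trans (Finset.sum_le_sum fun b _ => ?_)
  have hK := hω.abs_meanEnergy_vectorHopping_le_four_div_pi (hw b) 1 (hwR' b)
  rw [abs_one, mul_one] at hK
  rw [← sub_mul, abs_mul, mul_comm (4 / Real.pi)]
  exact mul_le_mul_of_nonneg_left hK (abs_nonneg _)

/-- **Equilibrium marginals of a layered crystal**: the layer marginal of any equilibrium state of `(β, layered)` is an
`|β|(4/π)Σ|tz|`-approximate equilibrium of the one-band model:
`P_d(β, one band) − |β|(4/π)Σ_b|tz_b| ≤ s̄(ω∘Γ_layer) − β e_{one band}(ω∘Γ_layer)` — so §3 applies to it with `ε = |β|(4/π)Σ|tz|`.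
[cite: BratteliKishimotoRobinson1978, Thm. 2 (condition 2)] [cite: ArakiMoriya2003, Theorem 12.11] -/
theorem InfVolFermionState.IsVarEquilibrium.layerMarginal_layeredModel (hd : 0 < d) {β : ℝ} (U : ℝ) {u : ι → Site d}
    (hu : ∀ a, u a ≠ 0) (θ : ι → ℝ) {w : κ → Site (d + 1)} (hw : ∀ b, w b 0 ≠ 0) (tz : κ → ℝ) {R R' : ℝ} (hR : 1 ≤ R)
    (hRR' : R ≤ R') (huR : ∀ a, u a ∈ thicken ({0} : Finset (Site d)) R)
    (hwR' : ∀ b, w b ∈ thicken ({0} : Finset (Site (d + 1))) R') {ω : InfVolFermionState (d + 1)}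
    (hω : ω.IsVarEquilibrium β (layeredModel U u θ w tz) R') :
    (vectorHoppingModel U u θ).varPressure β R - |β| * (4 / Real.pi * ∑ b, |tz b|) ≤
      (ω.mapAct (layerHom d) (layerHom_injective d)).entropyDensitySup -
        β * (ω.mapAct (layerHom d) (layerHom_injective d)).meanEnergy (vectorHoppingModel U u θ) R :=
  hω.varPressure_sub_le_layerMarginal β hd
    (meanEnergy_stack_layeredModel_of_isTranslationInvariant hd U hu θ hw tz hR hRR' huR hwR')
    (fun ω hω => hω.abs_meanEnergy_layeredModel_sub_mapAct_le U hu θ (fun b h0 => hw b (by rw [h0]; rfl)) tz hR hRR'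
      huR hwR')

/-! #### The `t–t'` Hubbard layer -/

/-- **T > 0 DIMENSION RAISING FOR THE LAYERED `t–t'` HUBBARD CRYSTAL** (interaction form, any `β`, interlayer vectors `w_b` with
`(w_b)₀ ≠ 0` in the range box `R' ≥ 1`):
`P_3(β, layeredHubbardTTPrime t t' U w tz) ∈ [P_2(β, Φ(t,t',U)), P_2(β, Φ(t,t',U)) + |β|(4/π)Σ_b|tz_b|]`.
[cite: BratteliKishimotoRobinson1978, Thm. 2 (condition 2)] [cite: Israel1979, Thm. I.3.4] -/
theorem varPressure_layeredHubbardTTPrime_mem_Icc (β t t' U : ℝ) {w : κ → Site 3} (hw : ∀ b, w b 0 ≠ 0) (tz : κ → ℝ)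
    {R' : ℝ} (hR' : 1 ≤ R') (hwR' : ∀ b, w b ∈ thicken ({0} : Finset (Site 3)) R') :
    (layeredHubbardTTPrime t t' U w tz).varPressure β R' ∈
      Set.Icc ((hubbardTTPrimeFermionInteraction t t' U).varPressure β 1)
        ((hubbardTTPrimeFermionInteraction t t' U).varPressure β 1 + |β| * (4 / Real.pi * ∑ b, |tz b|)) := by
  rw [hubbardTTPrimeFermionInteraction_eq_vectorHoppingModel]
  exact varPressure_layeredModel_mem_Icc two_pos β U ttPrimeVec_ne_zero (ttPrimeAmp t t') hw tz le_rfl hR'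
    ttPrimeVec_mem_thicken_one hwR'

/-- **Decoupled `t–t'` layers have the 2D variational pressure.** [cite: ArakiMoriya2003, §11.1 Theorem 11.2] -/
theorem varPressure_layeredHubbardTTPrime_zero (β t t' U : ℝ) {w : κ → Site 3} (hw : ∀ b, w b 0 ≠ 0)
    {R' : ℝ} (hR' : 1 ≤ R') (hwR' : ∀ b, w b ∈ thicken ({0} : Finset (Site 3)) R') :
    (layeredHubbardTTPrime t t' U w fun _ => 0).varPressure β R' = (hubbardTTPrimeFermionInteraction t t' U).varPressure β 1 := by
  rw [hubbardTTPrimeFermionInteraction_eq_vectorHoppingModel]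
  exact varPressure_layeredModel_zero two_pos β U ttPrimeVec_ne_zero (ttPrimeAmp t t') hw le_rfl hR'
    ttPrimeVec_mem_thicken_one hwR'

end Layered

end Literature.MathematicalPhysics.QuantumLattice

end
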